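import Mathlib
import Summits.Langlands.Langlands.Theses.PicardMuOrdinary
import Literature.NumberTheory.GaloisRepresentations.GaloisRep
import Literature.NumberTheory.GaloisRepresentations.AbsGaloisOuterConj
import Literature.NumberTheory.GaloisRepresentations.OrdinaryRegular
import Literature.NumberTheory.GaloisRepresentations.NearlyOrdinaryDeformationRing
import Literature.NumberTheory.GaloisRepresentations.SuperellipticTorsionRep
import Literature.NumberTheory.GaloisRepresentations.CubicResidueSymbol
import Literature.NumberTheory.Automorphic.ReciprocityGLn
import Literature.NumberTheory.Automorphic.ReciprocityGLnProofs
import Literature.RingTheory.KrullDimension.AffineDimension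
import Summits.Langlands.Langlands.Theorems.MuOrdinaryFamilyRT.Negative.AccumulationDominance
import Summits.Langlands.Langlands.Theorems.MuOrdinaryFamilyRT.Negative.AccumulationNormality
import Summits.Langlands.Langlands.Theorems.MuOrdinaryFamilyRT.Negative.AccumulateRegularity
import Summits.Langlands.Langlands.Theorems.MuOrdinaryFamilyRT.Negative.SepRedundant
import Summits.Langlands.Langlands.Theorems.MuOrdinaryFamilyRT.Negative.CongruenceEncoding
import Summits.Langlands.Langlands.Theorems.MuOrdinaryFamilyRT.Negative.GenericClass
import Summits.Langlands.Langlands.Theorems.MuOrdinaryFamilyRT.Negative.ZariskiVsPadicDensity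
import Summits.Langlands.Langlands.Theorems.MuOrdinaryFamilyRT.Negative.InertPrimeSquares

/-!
# Line `char-zero-dominance` — checked skeleton for the crux
`Summit.Langlands.Langlands.Theses.PicardMuOrdinary.MuOrdinaryFamilyRT` (stmt-Langlands-13757)

Planner crux-plan, round 1, GENERATION 2 (planner-cruxplan-stmt-Langlands-13757-char-zero-dominance-g2-0,
2026-08-16; gen 1 = planner-cruxplan-…-char-zero-dominance-0, same day); idea card
`Ideas/char-zero-dominance.md` (ideator 3), triage `TRIAGE-r1-2.md` / `TRIAGE-r1-3.md` (both PASS;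
merge-recommended with `weight-blind-lambda-adic-rt`), disproof file `Disproof.lean` (cycles 1–2: no
kill; load-bearing lemmas `AccumulationDominance`, `AccumulationNormality`, `AccumulateRegularity`), and
the refuter note `MuOrdinaryVacuity.md` (drefute-13758, 2026-08-16T03:26Z) which this generation answers.
Line card: `Lines/char-zero-dominance.md`.

## Gen-2 repair — the scope is now Galois-side and NON-EMPTY

Gen 1 scoped every in-scope stub by the curve-level Literature predicate
`Literature.AlgebraicGeometry.Motives.HasMuOrdinaryReductionAtThree f` ("`y³ = f(x)` has potentially
GOOD reduction at `3` with special fibre of `3`-rank `2`").  That class is EMPTY on `ℤ[x]`: a Picard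
curve over an absolutely unramified `3`-adic field whose stable reduction has a genus-`3` (étale)
component has ONE branch point — special fibre `y³ − y = x⁴`, `3`-rank `0`, supersingular — because an
element `τ` of the monodromy group with `τ(ζ₃) = ζ₃²` normalises `σ` to `σ²` and cannot fix two
ramification points with different jumps [BornerBouwWewers2017, §3.2: Lemma 3.3 (lem:zeta3), Lemma 3.4
(lem:genuscomp), Theorem 3.6; arXiv:1701.01986 pp. 6–7, read by this seat].  Hence gen 1's six genuine
stubs were vacuous and its `stub_remainder` was the crux verbatim — a costume.  The μ-ordinary members
of the family are NOT the curves with good `3`-rank-`2` reduction (there are none) but those of BBW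
stable type (b): two étale components of genera `2` and `1` meeting in one point, so that the JACOBIAN
has potentially good reduction `J(W₁) × J(W₂)` = (ordinary abelian surface with `ℤ[ω]`-action) ×
(supersingular elliptic curve), Newton polygon `(0,0,½,½,1,1)` — e.g. `y³ = 3x⁴ + x³ − 54`
[BornerBouwWewers2017, Example 3.8: type (b) over `ℚ₃^{nr}`, `f₃ = 4`], an `S₄`-quartic with
`disc = −2²·3⁹·5²·7·79` (neither `disc` nor `−3·disc` a square; cycle types `(4)`, `(1,3)`, `(1,1,2)`
mod small primes — this seat), i.e. a GENERIC `f` in the sense of the crux.  This generation therefore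
types the scope on the GALOIS side, on the representation `ρ_C` that Stub 1 produces:
`IsMuOrdinaryAtThree ρ_C` = "`ρ_C|Γ_{K_λ}` is B-ordinary of μ-ordinary shape": a `Γ_{K_λ}`-stable full
flag whose END diagonal characters are, on an open subgroup of inertia, `1` (unit root, Hodge–Tate
`(0,0)`) and `ε^{±1}` (slope one, Hodge–Tate `(1,1)`), in either order, and whose two ends are NOT Tate
twists of each other up to finite order ("pure unit root" — the very fact triage r1-2/r1-3 used to correct
the count's local term).  For Picard `ρ_C` this is exactly BBW type (b) (connected–multiplicative /
connected / étale filtration of `J[3^∞]` over the good-reduction field of `J`; canonical, hence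
`Γ_{K_λ}`-stable; purity of the unit-root Frobenius eigenvalue); the supersingular types (a), (c) have
no unit root, the toric types (d), (e) have one but their ends are Tate twists of each other up to the
finite torus character (`N ≠ 0`).  It is precisely the hypothesis under which the card's
characteristic-zero count is evaluated (card K2(i): unique flag; triage: purity), so no stub changes
meaning; only the conceded remainder grows by the toric types (d), (e) — which the same lever plausibly
reaches (Geraghty's `R^△` is equidimensional of the expected dimension at semistable ordinary points,
Hida families contain the semistable ordinary forms), recorded in the line card as the first widening
for the lead, NOT claimed here.

Notation in comments: `K = ℚ(ω) = CyclotomicField 3 ℚ`, `λ = (1 - ω)`, `ρ_C : Γ_K → GL₃(ℚ̄₃)` the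
`λ`-adic representation of the Picard curve `C : y³ = f(x)` (geometric-Frobenius trace
`ι⁻¹ e(a_𝔭(f))`, `a_𝔭 = picardTrace`), `r̄` its reduction = the heart `𝔽₃[roots f]/diag`,
`F' = K(√d)` (`d ≡ 6 mod 9`, `(d/ℓ) = -1` at inert bad `ℓ`) the auxiliary CM field in which `λ` and the
bad primes split, `Λ` a weight algebra (intended: the branch `𝒪⟦X₁,X₂,X₃⟧` of the polarized ordinary
weight space of `U(3)` carrying the weight `κ_C` of `ρ_C`).

## The lever, and how the skeleton cuts it

The idea: evaluate the Greenberg–Wiles / Poitou–Tate dimension count of the `Λ`-adic, polarized,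
`S`-unramified, B-ordinary deformation problem of `r̄` NOT at the residual point (where `ζ₃ ∈ K`,
`p = n = 3` costs `h⁰(G_ℚ, ad r̄(1)) = 1`) but at the CHARACTERISTIC-ZERO point `x_C = ρ_C`
(Kisin's generic fibre): there `h⁰(ad ρ_C(1)) ⊆ Hom_{G_K}(ρ_C, ρ_C(1)) = 0` (determinants), and the
count reads `0 − 0 + 6 + 0 − 3 = 3 = rank of weight space`, so the irreducible component `Z ∋ x_C` of
the deformation space has `dim Z ≥ 4 = dim Λ` — DOMINANCE of weight space by the component of `ρ_C`
is a theorem of deformation theory, not a hypothesis (triage N4; the Disproof's load-bearing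
`stub_accumulation_false_without_dominance`, p74393).  With finiteness over `Λ` (from the imported
`R^{red}_{F'} = T^{ord}_{F'}` over `F'`, where every place of `S ∪ {3}` splits) the open-mapping /
lying-over argument produces regular-weight points `y_k → x_C`, classical over `F'`, descended to `K`.

The skeleton does NOT try to pin "the universal deformation ring" by a universal property (the honest
local condition at the non-split, residually NON-distinguished `λ` is Geraghty's flag-scheme IMAGE
condition `△`, which is not first-order on Artinian points).  Instead it cuts the lever into an
EXISTENTIAL Galois-side statement and a UNIVERSAL automorphic-side statement over one typed notion,
`OrdFamily` = "an INTEGRAL (domain) `Λ`-adic family of `Γ_K`-representations through `ρ_C`, polarized,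
unramified outside `S₀`, B-ordinary at `λ` at every `ℚ̄₃`-point with ORDERED diagonal inertial
characters read by `Λ`, and topologically generated by its characteristic polynomials and weights"
(so that, on paper, it is a quotient of Geraghty's image ring `R^△ ⊗̂ Λ`; no residual
`λ`-distinguishedness is assumed anywhere — it fails for most μ-ordinary Picard curves):

* `stub_picardInput` (L) — `ρ_C` exists: absolutely irreducible, unramified outside a finite `S₀ ∋ λ`,
  geometric-Frobenius traces `ι⁻¹ e(a_𝔭(f))` (Tate module of the Picard Jacobian, `ω`-part).
* `stub_charZeroFamily` (L; THE LEVER, the card's K2) — for generic `f` whose `ρ_C` (Stub 1) is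
  μ-ordinary at `3` in the Galois-side sense (`IsMuOrdinaryAtThree ρ_C`, gen 2: BBW stable type (b))
  there is an `OrdFamily` through `ρ_C` whose ring `R` (a domain) has Krull dimension `≥ 4`.  Intended witness: `R = (R^{univ} ⊗̂ Λ)/𝔮`, `𝔮` the contraction of the
  analytic branch `Z ∋ x_C` of Geraghty's flag-pair germ; `dim ≥ 4` IS the characteristic-zero count
  (Kisin 2008 §2.3 representability at `x_C`, Poitou–Tate with `E`-coefficients, local terms
  `6 + h²(G_{ℚ₃}, 𝔟) − h⁰(G_{ℚ₃}, ad/𝔟) = 6` by Hodge–Tate weights and PURITY of the unit root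
  (triage r1-2/r1-3 correction), archimedean `−3`; catenarity, Ratliff equidimensionality of completions
  of excellent local domains and the dimension formula for the proper birational flag closure).
* `stub_definiteHost` (XL; HARDEST, the card's K1 = weight-blind's K1) — EVERY `OrdFamily` through
  `ρ_C` (for `(f, ρ_C)` in the main class: `ρ_C` μ-ordinary at `3`, `ρ̄_C(Γ_K) = S₄`) is module-finite
  over its weight
  algebra `Λ`, and its points over a set `D` of arithmetic weights accumulating at the weight of `x_C`
  are, after restriction to `Γ_{F'}`, the Galois representations of regular algebraic cuspidal
  representations of `GL₃(𝔸_{F'})` unramified outside `S'` (Geraghty-type `Λ`-adic ordinary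
  `R^{red} = T` on the definite `U(3)_{F'/ℚ(√d)}` at the SPLIT prime `3`, `p = n = 3`, `ζ₃ ∈ F'`,
  `S₄` `ad/𝔷`-adequate over `𝔽₉`; BLGGT finiteness of `R_K` over `R_{F'}`; Hida–Geraghty control;
  Labesse base change `U(3) → GL₃/F'`).
* DOMINANCE is then a kernel-checked lemma of this file (`algebraMap_injective_of_ringKrullDim_le`:
  `Λ` a domain of `dim ≤ 4`, `R` a domain of `dim ≥ 4`, finite over `Λ` ⇒ `Λ ↪ R`) — no stub.
* `stub_accumulation` (M/L, provable now) — VERBATIM weight-blind Stub C (the abstract accumulation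
  kernel: normal Noetherian `Λ`, finite `R`, dominating prime, root continuity); one proof serves both
  lines; TRUE on paper (Disproof cycle 1) with dominance and normality load-bearing (p74393, p74844).
* `stub_quadraticDescent` (L, known: Arthur–Clozel) — VERBATIM weight-blind Stub D.
* `stub_dictionary` (M, provable now) — VERBATIM weight-blind Stub E (`ℚ̄₃`-norm ↔ `ℤ̄_𝔐` congruence).
* `stub_remainder` — NOT a lemma of the line: the crux verbatim for generic `f` whose `ρ_C` is NOT
  μ-ordinary at `3` (BBW types (a), (c): λ-supersingular; (d), (e): toric rank `2` at `λ`) or has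
  `ρ̄_C(Γ_K) = A₄`; the route's foreseen `RTSupersingular`-type child (refuter O1, Disproof F8), recorded
  only so that the composition concludes the crux BY NAME for every generic `f`.  Gen 2: this class is
  now a GENUINE complement (gen 1's was everything).

`MuOrdinaryFamilyRT_of : S.stub_picardInput → … → S.stub_remainder → MuOrdinaryFamilyRT` is pure logic
plus the dominance lemma (kernel-checked; the only `sorry`s are the seven `theorem stub_*`).
`crux_iff = Iff.rfl` certifies that `ResidualHyp` / `LimitConcl` are the crux's halves verbatim.
All eight landed negative lemmas of this crux (`Negative/{SepRedundant, CongruenceEncoding,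
AccumulationDominance, AccumulationNormality, AccumulateRegularity, GenericClass, ZariskiVsPadicDensity,
InertPrimeSquares}`) are imported, and the two that bear on this line are referenced (see the `example`
after the dominance lemma), so this file is checked against them.
-/

set_option linter.dupNamespace false
set_option linter.unusedVariables false

namespace Summit.Langlands.Langlands.Cruxes.MuOrdinaryFamilyRT.CharZeroDominance

open scoped NumberField Polynomial Matrix Classical
open Field IsDedekindDomain Polynomial
open Literature.NumberTheory.GaloisRepresentations Literature.NumberTheory.Automorphic

noncomputable section

/-! ## 0. The base field and the crux, cut into hypothesis and conclusion -/

/-- `K = ℚ(ω)`. -/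
abbrev K : Type := CyclotomicField 3 ℚ

instance instIsGaloisK : IsGalois ℚ K := by
  haveI : IsCyclotomicExtension {3} ℚ K := CyclotomicField.isCyclotomicExtension 3 ℚ
  exact IsCyclotomicExtension.isGalois {3} ℚ K

/-- The crux's standing hypotheses on `f`: an integer quartic, separable, with `Gal ∈ {A₄, S₄}`. -/
def Generic (f : ℤ[X]) : Prop :=
  f.natDegree = 4 ∧ (f.map (Int.castRingHom ℚ)).Separable ∧ 12 ∣ Nat.card (f.map (Int.castRingHom ℚ)).Gal

/-- The crux's residual-automorphy hypothesis, VERBATIM (consumed only by `stub_remainder`: inside the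
main class the polarized ordinary seed over `F'` is part of `stub_definiteHost`). -/
def ResidualHyp (f : ℤ[X]) (hcpt : isCompact_glFiniteIntegralLevel 3 (CyclotomicField 3 ℚ)) : Prop :=
  ∃ (P : Literature.NumberTheory.Automorphic.CuspidalAutomorphicRepData 3 (CyclotomicField 3 ℚ) hcpt) (𝔐 : Ideal (integralClosure ℤ ℂ)), P.1.IsRegularAlgebraic ∧ 𝔐.IsMaximal ∧ (3 : (integralClosure ℤ ℂ)) ∈ 𝔐 ∧ ∀ᶠ 𝔭 : IsDedekindDomain.HeightOneSpectrum (NumberField.RingOfIntegers (CyclotomicField 3 ℚ)) in Filter.cofinite, ∃ (α : Multiset ℂ) (Q : Polynomial (integralClosure ℤ ℂ)), P.1.HasSatakeParamAt 𝔭 α ∧ Q.map (algebraMap (integralClosure ℤ ℂ) ℂ) = (α.map (fun a => Polynomial.X - Polynomial.C ((𝔭.residueCard : ℂ) * a))).prod ∧ Q.map (Ideal.Quotient.mk 𝔐) = (if (f.map ((Ideal.Quotient.mk 𝔭.asIdeal).comp (algebraMap ℤ (NumberField.RingOfIntegers (CyclotomicField 3 ℚ))))).roots.toFinset.card = 4 then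 (Polynomial.X - 1) ^ 3 else if (f.map ((Ideal.Quotient.mk 𝔭.asIdeal).comp (algebraMap ℤ (NumberField.RingOfIntegers (CyclotomicField 3 ℚ))))).roots.toFinset.card = 2 then (Polynomial.X - 1) ^ 2 * (Polynomial.X + 1) else if (f.map ((Ideal.Quotient.mk 𝔭.asIdeal).comp (algebraMap ℤ (NumberField.RingOfIntegers (CyclotomicField 3 ℚ))))).roots.toFinset.card = 1 then Polynomial.X ^ 3 - 1 else if (∃ y : ((NumberField.RingOfIntegers (CyclotomicField 3 ℚ)) ⧸ 𝔭.asIdeal), y ^ 2 = (f.map ((Ideal.Quotient.mk 𝔭.asIdeal).comp (algebraMap ℤ (NumberField.RingOfIntegers (CyclotomicField 3 ℚ))))).discr) then (Polynomial.X - 1) * (Polynomial.X + 1) ^ 2 else Polynomial.X ^ 3 + Polynomial.X ^ 2 + Polynomial.X + 1 : Polynomial ℤ).map (Int.castRingHom ((integralClosure ℤ ℂ) ⧸ 𝔐))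

/-- The crux's conclusion, VERBATIM: `ρ_C` is a 3-adic limit of regular algebraic cuspidal `P_k`. -/
def LimitConcl (f : ℤ[X]) (hcpt : isCompact_glFiniteIntegralLevel 3 (CyclotomicField 3 ℚ)) : Prop :=
  ∃ (e : CyclotomicField 3 ℚ →+* ℂ) (𝔐 : Ideal (integralClosure ℤ ℂ)) (S : Finset (IsDedekindDomain.HeightOneSpectrum (NumberField.RingOfIntegers (CyclotomicField 3 ℚ)))), 𝔐.IsMaximal ∧ (3 : (integralClosure ℤ ℂ)) ∈ 𝔐 ∧ ∀ k : ℕ, ∃ P : Literature.NumberTheory.Automorphic.CuspidalAutomorphicRepData 3 (CyclotomicField 3 ℚ) hcpt, P.1.IsRegularAlgebraic ∧ ∀ 𝔭 ∉ S, ∃ (α : Multiset ℂ) (t u : (integralClosure ℤ ℂ)), P.1.HasSatakeParamAt 𝔭 α ∧ (t : ℂ) = (𝔭.residueCard : ℂ) * α.sum - e (Literature.NumberTheory.GaloisRepresentations.picardTrace f 𝔭) ∧ u ∉ 𝔐 ∧ u * t ∈ Ideal.span {(3 : (integralClosure ℤ ℂ)) ^ k}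

/-- The crux is literally `∀ f hcpt, Generic-hypotheses → ResidualHyp → LimitConcl`. -/
theorem crux_iff :
    Summit.Langlands.Langlands.Theses.PicardMuOrdinary.MuOrdinaryFamilyRT ↔
      ∀ (f : ℤ[X]) (hcpt : isCompact_glFiniteIntegralLevel 3 (CyclotomicField 3 ℚ)),
        f.natDegree = 4 → (f.map (Int.castRingHom ℚ)).Separable →
          12 ∣ Nat.card (f.map (Int.castRingHom ℚ)).Gal → ResidualHyp f hcpt → LimitConcl f hcpt :=
  Iff.rfl

/-! ## 1. The Galois input `ρ_C` -/

/-- **Picard Galois input** for `(f, ι, e)`: a finite set `S₀` of finite places of `K` containing every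
place above `3`, and a continuous `ρ : Γ_K → GL₃(ℚ̄₃)` (intended: the `ω`-part of the `3`-adic
cohomology of `C : y³ = f(x)`, read through `e`/`ι`) which is absolutely irreducible (its reduction is
the reflection representation of `Gal(f) ∈ {A₄, S₄}` on `𝔽₃⁴/diag`, Poonen–Schaefer / Upton / Zarhin),
unramified at every `𝔭 ∉ S₀`, with GEOMETRIC-Frobenius trace `ι⁻¹(e(a_𝔭(f)))` there (Lefschetz on
the `ω`-eigenpart; sign/eigenpart conventions absorbed by `e`, as in the crux and as audited by the
refuter).  Verbatim the output of weight-blind's Stub A. -/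
def PicardInput (f : ℤ[X]) (ι : PadicAlgCl 3 ≃+* ℂ) (e : K →+* ℂ)
    (S₀ : Finset (HeightOneSpectrum (𝓞 K))) (ρ : FramedGaloisRep K (PadicAlgCl 3) 3) : Prop :=
  (∀ v : HeightOneSpectrum (𝓞 K), ((3 : ℕ) : 𝓞 K) ∈ v.asIdeal → v ∈ S₀) ∧
  FramedRep.IsAbsolutelyIrreducible ρ ∧
  ∀ 𝔭 ∉ S₀, ρ.IsUnramifiedAt 𝔭 ∧
    ∀ 𝔓 ∈ 𝔭.primesAbove, ∀ τ : absoluteGaloisGroup K,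
      IsArithFrobAt (𝓞 K) τ 𝔓 → FramedRep.trace ρ τ⁻¹ = ι.symm (e (picardTrace f 𝔭))

/-! ## 2. Residual data: the framed heart -/

/-- The roots of `f` in `K̄` (a finite `Γ_K`-set with 4 elements for generic `f`). -/
abbrev Roots (f : ℤ[X]) : Type := ((f.map (algebraMap ℤ K)).rootSet (AlgebraicClosure K))

/-- **The framed heart (branch-point) representation** `r̄_f^B : Γ_K → GL₃(𝔽₃)`: the tree's
`heartRep 3` on `𝔽₃^{roots}/𝔽₃·1 ≅ J(C_f)[1-ω]` (Poonen–Schaefer; `superelliptic_lambdaTorsion_iso_heart`)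
in the basis `B`. -/
def rbar (f : ℤ[X]) (B : Module.Basis (Fin 3) (ZMod 3) (Heart 3 (Roots f))) :
    absoluteGaloisGroup K →* GL (Fin 3) (ZMod 3) :=
  (Units.map ((LinearMap.toMatrixAlgEquiv B).toRingEquiv.toMonoidHom)).comp
    (heartRep 3 (Roots f) (absoluteGaloisGroup K)).asGroupHom

/-- A `3 × 3` matrix is upper triangular. -/
def IsUpper3 {R : Type*} [CommRing R] (M : Matrix (Fin 3) (Fin 3) R) : Prop :=
  M 1 0 = 0 ∧ M 2 0 = 0 ∧ M 2 1 = 0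

/-! ## 2b. The scope of the line (gen 2): μ-ordinarity of `ρ_C` at `λ`, Galois side -/

/-- **`ρ` is μ-ordinary at `3` (Galois side; GEN-2 SCOPE of the line).**  For
`ρ : Γ_K → GL₃(ℚ̄₃)` (intended: `ρ_C` of Stub 1): at the place `v ∣ 3` of `K` (there is exactly one,
`λ = (1 − ω)`; `K_λ = ℚ₃(ω)`) there is a frame `g` in which the WHOLE decomposition group `Γ_{K_v}` acts
upper triangularly — a `Γ_{K_v}`-stable full flag — such that, on an open subgroup `U` of `Γ_{K_v}`
intersected with inertia, one END diagonal character (index `i ∈ {0, 2}`) is trivial — the unit-root end,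
Hodge–Tate type `(0,0)` — and the other end (`k ∈ {0, 2}`, `k ≠ i`) is `ε^s`, `s = ±1` — the slope-one
end, Hodge–Tate `(1,1)` — in either order and with either sign (duality / Frobenius conventions of
`PicardInput` are absorbed; the middle character is then forced to have type `(0,1)` by `det ρ_C`); AND
("pure unit root") on NO open subgroup `U'` of `Γ_{K_v}` is the `k`-th diagonal character equal to `ε^s`
times the `i`-th: the character `ψ_k ψ_i⁻¹ ε^{-s}`, unramified on `U` by the first clause, has infinite
order (for the Picard motive its Frobenius value has complex absolute value `q^{∓1} ≠ 1`: purity of the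
unit-root eigenvalue — exactly the fact by which triage r1-2 / r1-3 corrected the count's local term
`h²(G_{ℚ₃}, 𝔟) = 0`).  For the `λ`-adic representation of a Picard curve `y³ = f(x)`, `f ∈ ℤ[x]`, this
is STABLE REDUCTION TYPE (b) of [BornerBouwWewers2017, Theorem 3.1] at `p = 3`: two étale components of
genera `2` and `1` meeting in one point, i.e. the Jacobian has potentially GOOD reduction
`J(W₁) × J(W₂)` = (ordinary abelian surface, `y³ − y = x + x⁻¹` type, `3`-rank `2` by Deuring–Šafarevič)
× (supersingular elliptic curve `y³ − y = x²`), Newton polygon `(0,0,½,½,1,1)`; the flag is the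
connected–multiplicative ⊂ connected ⊂ all filtration of `T₃ J[3^∞]` over the good-reduction field of
`J` (each graded piece free of rank one over `ℤ₃[ω]`), canonical (Tate's full faithfulness) hence
`Γ_{K_λ}`-stable.  The supersingular types (a), (c) have no unit root (ends clause fails); the toric
types (d), (e) have the flag but their ends are Tate twists of each other up to the finite torus
character (monodromy `N ≠ 0`; purity clause fails).  This predicate REPLACES gen 1's curve-level
`Literature.AlgebraicGeometry.Motives.HasMuOrdinaryReductionAtThree f` (good reduction of the CURVE with
`3`-rank `2`), which is EMPTY on `ℤ[x]` [BornerBouwWewers2017, §3.2, Lemma 3.4 and Theorem 3.6: over an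
absolutely unramified base a genus-`3` étale component has one branch point, `y³ − y = x⁴`, `3`-rank `0`;
refuter note `MuOrdinaryVacuity.md` on this crux].  NON-EMPTY on the crux's generic class:
`f = 3x⁴ + x³ − 54` [BornerBouwWewers2017, Example 3.8: type (b), `f₃ = 4`] has `Gal = S₄` and
`disc = −2²·3⁹·5²·7·79` with neither `disc` nor `−3·disc` a square (this seat), and the stable type is a
`3`-adically open condition on `f`. -/
def IsMuOrdinaryAtThree (ρ : FramedGaloisRep K (PadicAlgCl 3) 3) : Prop :=
  ∀ v : HeightOneSpectrum (𝓞 K), (3 : 𝓞 K) ∈ v.asIdeal →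
    ∃ (g : GL (Fin 3) (PadicAlgCl 3)) (U : OpenSubgroup (absoluteGaloisGroup (v.adicCompletion K)))
      (i k : Fin 3) (s : ℤ),
      i ≠ k ∧ (i = 0 ∨ i = 2) ∧ (k = 0 ∨ k = 2) ∧ (s = 1 ∨ s = -1) ∧
      (∀ τ : absoluteGaloisGroup (v.adicCompletion K),
        IsUpper3 (g⁻¹ * ρ (absGaloisRestrict K (v.adicCompletion K) τ) * g).val) ∧
      (∀ τ ∈ absInertia (v.adicCompletion K), τ ∈ U →
        (g⁻¹ * ρ (absGaloisRestrict K (v.adicCompletion K) τ) * g).val i i = 1 ∧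
        (g⁻¹ * ρ (absGaloisRestrict K (v.adicCompletion K) τ) * g).val k k =
          algebraMap ℤ_[3] (PadicAlgCl 3)
            (((GaloisRep.cyclotomicCharacter (v.adicCompletion K) 3 τ) ^ s : ℤ_[3]ˣ) : ℤ_[3])) ∧
      (∀ U' : OpenSubgroup (absoluteGaloisGroup (v.adicCompletion K)), ∃ τ ∈ U',
        (g⁻¹ * ρ (absGaloisRestrict K (v.adicCompletion K) τ) * g).val k k ≠
          algebraMap ℤ_[3] (PadicAlgCl 3)
              (((GaloisRep.cyclotomicCharacter (v.adicCompletion K) 3 τ) ^ s : ℤ_[3]ˣ) : ℤ_[3]) *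
            (g⁻¹ * ρ (absGaloisRestrict K (v.adicCompletion K) τ) * g).val i i)

/-- **The main class** of the line (gen 2): the Picard representation `ρ_C` of Stub 1 is μ-ordinary at
`3` in the Galois-side sense `IsMuOrdinaryAtThree` (BBW stable type (b): Jacobian potentially good with
`3`-rank `2`), AND the image of `ρ̄_C|Γ_K` on the heart is all of `S₄`
(`disc f ∉ ℚ^{×2} ∪ −3·ℚ^{×2}`), so that it is still `S₄` over the auxiliary CM field `F' = K(√d)` —
the hypothesis under which `stub_definiteHost`'s patching over `F'` is stated (`A₄` is Taylor–Wiles-dead: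
`H¹(A₄, 𝔽₃) ≠ 0`, kit j007087/j007470).  `PicardInput` pins `ρ_C` up to isomorphism (absolutely
irreducible, traces on a density-one set of Frobenii), and `IsMuOrdinaryAtThree` is isomorphism
invariant, so this is a condition on `f` alone; it is typed on the pair `(f, ρ_C)` to keep the glue
purely logical.  Witness of non-vacuity: `f = 3x⁴ + x³ − 54` (docstring above). -/
def MainClass (f : ℤ[X]) (ρC : FramedGaloisRep K (PadicAlgCl 3) 3) : Prop :=
  IsMuOrdinaryAtThree ρC ∧
    ¬ IsSquare (f.map (Int.castRingHom ℚ)).discr ∧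
    ¬ IsSquare ((-3 : ℚ) * (f.map (Int.castRingHom ℚ)).discr)

/-! ## 3. The typed notion of the line: a B-ordinary polarized `Λ`-adic family through `ρ_C` -/

/-- **`OrdFamily f ι e S₀ ρC` — an INTEGRAL `Λ`-adic B-ordinary polarized family of
`Γ_K`-representations through `ρ_C`.**  Data: a coefficient ring `𝒪` (integers of a finite `E₀/ℚ₃`,
residue field `𝔽₃`, embedded in `ℚ̄₃` by `j`); a complete Noetherian local DOMAIN `R` over `𝒪` with
residue field `𝔽₃` (augmentation `π`; `𝒪 ↪ R` because `x` below is a section, so `3 ≠ 0` in `R`);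
a profinitely continuous `ρ : Γ_K → GL₃(R)` lifting the framed heart `r̄_f^B`, unramified outside `S₀`,
POLARIZED in trace form (`tr ρ(θ_c σ) = ε(σ)^m · tr ρ(σ⁻¹)` for complex conjugations `c ∈ Γ_ℚ`, `θ_c`
the outer conjugation; for the Picard motive `m = -1` up to the duality convention, absorbed by
`m : ℤ`); a weight algebra `Λ` — a normal Noetherian domain of Krull dimension `≤ 4` acting on `R`
(intended: the branch `𝒪⟦X₁,X₂,X₃⟧` of the rank-3 polarized ordinary weight space of `U(3)_{K/ℚ}` on
which the weight of `ρ_C` lies; `Spec` of the full Iwasawa algebra `𝒪⟦T(ℤ₃)⟧` is a union of such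
branches indexed by the characters of the torsion `μ₃ × …` of `T(ℤ₃)`, meeting only in the special
fibre), with CLOSED IMAGE in `R` — together with ORDERED WEIGHT CHARACTERS `wt v i : Γ_{K_v} → Λ`
(`v ∣ 3`, `i = 0,1,2`; only their values on inertia matter), multiplicative and continuous on inertia,
whose values together with `𝒪` topologically generate the image of `Λ` (so that this image IS the image
of the Iwasawa algebra `𝒪⟦I_{K_λ}^{ab}⟧³` under the weight characters — the weight algebra of the
family, no bigger and no smaller); GENERATION: `R` is topologically generated over `Λ` by the coefficients
of the characteristic polynomials `charpoly ρ(σ)`, `σ ∈ Γ_K` (Chenevier: a determinant law is determined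
by the characteristic polynomials of group elements, and for the absolutely irreducible `r̄` deformations
= determinant deformations — so on paper `R` is a QUOTIENT of `R^{univ}_{S₀,pol} ⊗̂_𝒪 Λ`); POINTWISE
B-ORDINARITY AT `λ` (Geraghty's image condition `△`, stated on points, which is all the automorphic side
uses): at EVERY `ℚ̄₃`-valued point `z` of `R`, `ρ_z|_{Γ_{K_v}}` (`v ∣ 3`) is upper triangular in some
frame with `i`-th diagonal character equal to `z ∘ wt v i` on inertia (for the intended witness — the
image of an irreducible component of Geraghty's proper flag scheme `𝒢` — every point lies in the closed
`△`-locus, and points of a scheme-theoretic image of a proper map lift); and THE PICARD POINT `x : R → 𝒪`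
with `j ∘ x ∘ tr ρ = tr ρ_C` on all of `Γ_K`, whose weight has the μ-ORDINARY END SHAPE: on an open
subgroup of inertia one end character `x ∘ wt v i` (`i ∈ {0, 2}`) is trivial (the unit root: Hodge–Tate
`(0,0)`, crystalline hence unramified over the good-reduction field of `J`) and the other end is
`ε^{±1}` (the slope-one piece, Hodge–Tate `(1,1)`), in either order (duality convention) — this excludes
the anti-ordinary stable flags that exist when `ρ_C|Γ_{K_λ}` happens to split, and nothing else; gen 2:
it is the family-side copy of the ends clause of the HYPOTHESIS `IsMuOrdinaryAtThree ρ_C`.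
Because `R` is a domain of characteristic zero, its `ℚ̄₃`-points are Zariski dense (`R[1/3]` is
Jacobson), so pointwise `△` + generation make `R` a quotient of Geraghty's `R^△ ⊗̂ Λ` on paper — which
is why finiteness over `Λ` (`stub_definiteHost`) is an honest consequence of `R^{△,red} = T` and not of
the typing.  No finiteness, universality or dimension statement is part of the notion: those are the
CONTENT of `stub_definiteHost` resp. `stub_charZeroFamily`. -/
structure OrdFamily (f : ℤ[X]) (ι : PadicAlgCl 3 ≃+* ℂ) (e : K →+* ℂ)
    (S₀ : Finset (HeightOneSpectrum (𝓞 K))) (ρC : FramedGaloisRep K (PadicAlgCl 3) 3) : Type 1 where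
  /-- Coefficients: `𝒪 = 𝒪_{E₀}`, a DVR finite over `ℤ₃` with residue field `𝔽₃`. -/
  𝒪 : Type
  [instCommRing : CommRing 𝒪]
  [instIsDomain : IsDomain 𝒪]
  [instDVR : IsDiscreteValuationRing 𝒪]
  [instAlgebra : Algebra ℤ_[3] 𝒪]
  [instFinite : Module.Finite ℤ_[3] 𝒪]
  [instAlgebraRes : Algebra 𝒪 (ZMod 3)]
  residue_surjective : Function.Surjective (algebraMap 𝒪 (ZMod 3))
  /-- `𝒪 ↪ ℚ̄₃`, compatibly with `ℤ₃`; values are integral (norm `≤ 1`). -/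
  j : 𝒪 →+* PadicAlgCl 3
  j_injective : Function.Injective j
  j_comp : j.comp (algebraMap ℤ_[3] 𝒪) = algebraMap ℤ_[3] (PadicAlgCl 3)
  j_norm_le : ∀ a : 𝒪, ‖j a‖ ≤ 1
  /-- A basis of the heart (the residual frame) and the polarization exponent. -/
  B : Module.Basis (Fin 3) (ZMod 3) (Heart 3 (Roots f))
  m : ℤ
  /-- The ring of the family: a complete Noetherian local `𝒪`-DOMAIN with residue field `𝔽₃`. -/
  R : Type
  [instCommRingR : CommRing R]
  [instIsDomainR : IsDomain R]
  [instIsLocalRingR : IsLocalRing R]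
  [instIsNoetherianRingR : IsNoetherianRing R]
  [instAlgebraR : Algebra 𝒪 R]
  [instIsAdicCompleteR : IsAdicComplete (IsLocalRing.maximalIdeal R) R]
  π : R →ₐ[𝒪] ZMod 3
  π_surjective : Function.Surjective π
  /-- The family `ρ : Γ_K → GL₃(R)`: continuous, lifts `r̄_f^B`, unramified outside `S₀`, polarized. -/
  ρ : absoluteGaloisGroup K →* GL (Fin 3) R
  continuous : Deformation.IsAdicContinuous ρ
  residual : ∀ σ, (ρ σ).val.map (π : R →+* ZMod 3) = (rbar f B σ).val
  unramified : ∀ v : HeightOneSpectrum (𝓞 K), v ∉ S₀ → Deformation.IsUnramifiedAt v ρ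
  polarized : ∀ c : absoluteGaloisGroup ℚ, IsComplexConjugation (algebraMap ℚ ℝ) c →
    ∀ σ, (ρ (absGaloisOuterConj ℚ K c σ)).val.trace =
      algebraMap 𝒪 R (algebraMap ℤ_[3] 𝒪 (((GaloisRep.cyclotomicCharacter K 3 σ) ^ m : ℤ_[3]ˣ) : ℤ_[3])) *
        (ρ σ⁻¹).val.trace
  /-- The weight algebra: a normal Noetherian domain of dimension `≤ 4` acting on `R`, with the
  ordered weight characters `wt v i` at the places `v ∣ 3` (junk at `v ∤ 3`). -/
  Λ : Type
  [instCommRingΛ : CommRing Λ]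
  [instIsDomainΛ : IsDomain Λ]
  [instIsNoetherianRingΛ : IsNoetherianRing Λ]
  [instIsIntegrallyClosedΛ : IsIntegrallyClosed Λ]
  [instAlgebraΛ : Algebra Λ R]
  dim_le : ringKrullDim Λ ≤ (4 : ℕ)
  wt : (v : HeightOneSpectrum (𝓞 K)) → Fin 3 → absoluteGaloisGroup (v.adicCompletion K) → Λ
  /-- The weight characters are multiplicative and (`𝔪_R`-adically) continuous on inertia. -/
  wt_mul : ∀ v : HeightOneSpectrum (𝓞 K), (3 : 𝓞 K) ∈ v.asIdeal → ∀ i : Fin 3,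
    ∀ τ ∈ absInertia (v.adicCompletion K), ∀ τ' ∈ absInertia (v.adicCompletion K),
      wt v i (τ * τ') = wt v i τ * wt v i τ'
  wt_cont : ∀ v : HeightOneSpectrum (𝓞 K), (3 : 𝓞 K) ∈ v.asIdeal → ∀ (i : Fin 3) (N : ℕ),
    ∃ U : OpenSubgroup (absoluteGaloisGroup (v.adicCompletion K)),
      ∀ τ ∈ absInertia (v.adicCompletion K), τ ∈ U →
        algebraMap Λ R (wt v i τ) - 1 ∈ IsLocalRing.maximalIdeal R ^ N
  /-- `Λ` has closed image in `R` (it is meant to be a complete local ring mapping continuously) … -/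
  closedRange : ∀ r : R,
    (∀ N : ℕ, ∃ a : Λ, r - algebraMap Λ R a ∈ IsLocalRing.maximalIdeal R ^ N) →
      r ∈ (algebraMap Λ R).range
  /-- … and that image is topologically generated by `𝒪` and the values of the weight characters on
  inertia: `Λ` is THE weight algebra of the family, no bigger (this excludes `Λ := R`-type junk). -/
  weightsGenerate : ∀ (a : Λ) (N : ℕ),
    ∃ b ∈ Algebra.adjoin ℤ
        ({c : R | ∃ (v : HeightOneSpectrum (𝓞 K)) (i : Fin 3)
            (τ : absoluteGaloisGroup (v.adicCompletion K)),
            (3 : 𝓞 K) ∈ v.asIdeal ∧ τ ∈ absInertia (v.adicCompletion K) ∧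
              c = algebraMap Λ R (wt v i τ)} ∪ Set.range (algebraMap 𝒪 R)),
      algebraMap Λ R a - b ∈ IsLocalRing.maximalIdeal R ^ N
  /-- `R` is topologically generated over `Λ` by the characteristic polynomials of the family. -/
  generated : ∀ (r : R) (N : ℕ),
    ∃ a ∈ Algebra.adjoin Λ {c : R | ∃ (σ : absoluteGaloisGroup K) (i : ℕ), c = ((ρ σ).val.charpoly).coeff i},
      r - a ∈ IsLocalRing.maximalIdeal R ^ N
  /-- Pointwise B-ordinarity at `λ` with ordered diagonal inertial characters `z ∘ wt v i`. -/
  ordinaryAt : ∀ (z : R →+* PadicAlgCl 3) (v : HeightOneSpectrum (𝓞 K)), (3 : 𝓞 K) ∈ v.asIdeal →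
    ∃ g : GL (Fin 3) (PadicAlgCl 3),
      (∀ τ, IsUpper3 (g⁻¹ * Matrix.GeneralLinearGroup.map z
        (ρ (absGaloisRestrict K (v.adicCompletion K) τ)) * g).val) ∧
      ∀ τ ∈ absInertia (v.adicCompletion K), ∀ i : Fin 3,
        (g⁻¹ * Matrix.GeneralLinearGroup.map z (ρ (absGaloisRestrict K (v.adicCompletion K) τ)) * g).val
            i i = z (algebraMap Λ R (wt v i τ))
  /-- The Picard point: `x ∘ ρ` has the traces of `ρ_C`. -/
  x : R →ₐ[𝒪] 𝒪
  x_trace : ∀ σ : absoluteGaloisGroup K, j (x (ρ σ).val.trace) = FramedRep.trace ρC σ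
  /-- μ-ordinary end shape of the weight of `x`: on an open subgroup of inertia at `λ`, one end
  character is trivial and the other is `ε^{±1}`. -/
  ends : ∀ v : HeightOneSpectrum (𝓞 K), (3 : 𝓞 K) ∈ v.asIdeal →
    ∃ (U : OpenSubgroup (absoluteGaloisGroup (v.adicCompletion K))) (i k : Fin 3) (s : ℤ),
      i ≠ k ∧ (i = 0 ∨ i = 2) ∧ (k = 0 ∨ k = 2) ∧ (s = 1 ∨ s = -1) ∧
      ∀ τ ∈ absInertia (v.adicCompletion K), τ ∈ U →
        j (x (algebraMap Λ R (wt v i τ))) = 1 ∧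
        j (x (algebraMap Λ R (wt v k τ))) =
          algebraMap ℤ_[3] (PadicAlgCl 3)
            (((GaloisRep.cyclotomicCharacter (v.adicCompletion K) 3 τ) ^ s : ℤ_[3]ˣ) : ℤ_[3])

attribute [instance] OrdFamily.instCommRing OrdFamily.instIsDomain OrdFamily.instDVR
  OrdFamily.instAlgebra OrdFamily.instFinite OrdFamily.instAlgebraRes
  OrdFamily.instCommRingR OrdFamily.instIsDomainR OrdFamily.instIsLocalRingR
  OrdFamily.instIsNoetherianRingR OrdFamily.instAlgebraR OrdFamily.instIsAdicCompleteR
  OrdFamily.instCommRingΛ OrdFamily.instIsDomainΛ OrdFamily.instIsNoetherianRingΛ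
  OrdFamily.instIsIntegrallyClosedΛ OrdFamily.instAlgebraΛ

/-! ## 4. Dominance is free: the kernel-checked algebra of the line -/

/-- **Dominance lemma (proved, no stub).**  If `Λ` is a domain of Krull dimension `≤ n`, `R` a
domain of Krull dimension `≥ n`, and `R` is module-finite over `Λ`, then `Λ → R` is injective: else
`R` would be integral over the proper quotient `Λ ⧸ ker`, of dimension `≤ n - 1` (incomparability,
`Literature.RingTheory.KrullDimension.ringKrullDim_le_of_isIntegral`; a non-zero prime of a domain drops
the dimension, `ringKrullDim_quotient_add_one_le`).  With `n = 4 = 1 + rank of weight space` this is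
"the component of `ρ_C` DOMINATES weight space" — the conjunct the Disproof proved load-bearing
(`stub_accumulation_false_without_dominance`, p74393) — obtained from the characteristic-zero count
(`stub_charZeroFamily`) and finiteness (`stub_definiteHost`). [folklore] -/
theorem algebraMap_injective_of_ringKrullDim_le {Λ R : Type*} [CommRing Λ] [IsDomain Λ]
    [CommRing R] [Algebra Λ R] [Module.Finite Λ R] {n : ℕ}
    (hΛ : ringKrullDim Λ ≤ n) (hR : (n : WithBot ℕ∞) ≤ ringKrullDim R) :
    Function.Injective (algebraMap Λ R) := by
  rw [RingHom.injective_iff_ker_eq_bot]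
  by_contra hker
  have hcomap : (⊥ : Ideal R).comap (algebraMap Λ R) = RingHom.ker (algebraMap Λ R) := by
    rw [← RingHom.ker_eq_comap_bot]
  have h1 : ringKrullDim (R ⧸ (⊥ : Ideal R)) ≤
      ringKrullDim (Λ ⧸ (⊥ : Ideal R).comap (algebraMap Λ R)) :=
    Literature.RingTheory.KrullDimension.ringKrullDim_le_of_isIntegral
  have h2 : ringKrullDim (Λ ⧸ (⊥ : Ideal R).comap (algebraMap Λ R)) + 1 ≤ ringKrullDim Λ :=
    Literature.RingTheory.KrullDimension.ringKrullDim_quotient_add_one_le (by rwa [hcomap])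
  have h3 : ringKrullDim (R ⧸ (⊥ : Ideal R)) = ringKrullDim R :=
    ringKrullDim_eq_of_ringEquiv (RingEquiv.quotientBot R)
  have h4 : (n : WithBot ℕ∞) + 1 ≤ n :=
    calc (n : WithBot ℕ∞) + 1 ≤ ringKrullDim R + 1 := add_le_add hR le_rfl
      _ = ringKrullDim (R ⧸ (⊥ : Ideal R)) + 1 := by rw [h3]
      _ ≤ ringKrullDim (Λ ⧸ (⊥ : Ideal R).comap (algebraMap Λ R)) + 1 := add_le_add h1 le_rfl
      _ ≤ ringKrullDim Λ := h2
      _ ≤ n := hΛ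
  have h5 : ((n + 1 : ℕ) : WithBot ℕ∞) ≤ ((n : ℕ) : WithBot ℕ∞) := by exact_mod_cast h4
  have h6 : n + 1 ≤ n := by exact_mod_cast h5
  omega

/-- Checked against the landed negative lemmas of this crux: `AccumulationDominance` (p74393: the
accumulation kernel is false without the dominance conjunct — here supplied by the lemma above) and
`AccumulationNormality` (p74844: normality of `Λ` is load-bearing — here `Λ` is a normal domain by the
definition of `OrdFamily`).  Both are imported; this `example` pins the references. -/
example : True := by
  have _hD := @Summit.Langlands.Langlands.Theorems.MuOrdinaryFamilyRT.Negative.stub_accumulation_false_without_dominance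
  have _hN := @Summit.Langlands.Langlands.Theorems.MuOrdinaryFamilyRT.Negative.stub_accumulation_false_without_normality
  trivial

/-! ## 5. The seven stubs (statements `S.stub_*`; the registered stubs are the sorried `theorem stub_*`) -/

/-- STUB 1 — **the Picard Galois input** (size L; Tate module of the Picard Jacobian is not in Mathlib,
the tree has `SuperellipticTorsionRep`, `CubicResidueSymbol`).  For generic `f` there are `ι : ℚ̄₃ ≃ ℂ`,
`e : K → ℂ`, a finite `S₀ ∋ λ` (the bad primes) and `ρ_C` with `PicardInput f ι e S₀ ρ_C`: absolutely
irreducible (the reduction `𝔽₃⁴/diag` of `A₄/S₄` is absolutely irreducible: `4 ≢ 0 mod 3`, kit j007087),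
unramified outside `S₀` (Néron–Ogg–Shafarevich) with geometric-Frobenius trace `ι⁻¹ e(a_𝔭(f))`
(Lefschetz trace formula on the `ω`-eigenpart of `H¹`: `#C(k_𝔭) = N𝔭 + 1 + S_χ + S_χ̄`).  Verbatim
weight-blind's Stub A. -/
def S.stub_picardInput : Prop :=
  ∀ (f : ℤ[X]), Generic f →
    ∃ (ι : PadicAlgCl 3 ≃+* ℂ) (e : K →+* ℂ) (S₀ : Finset (HeightOneSpectrum (𝓞 K)))
      (ρ : FramedGaloisRep K (PadicAlgCl 3) 3), PicardInput f ι e S₀ ρ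

/-- STUB 2 — **THE LEVER: the characteristic-zero count gives an integral 4-dimensional ordinary family
through `ρ_C`** (the card's K2; size L).  For `f` generic and `ρ_C` as in Stub 1 which is μ-ordinary at
`3` in the Galois-side sense `IsMuOrdinaryAtThree ρ_C` (gen 2; BBW stable type (b): `Γ_{K_λ}`-stable flag,
ends `1` / `ε^{±1}` on open inertia, pure unit root) there is an `OrdFamily` through `ρ_C` (in particular: a complete local Noetherian DOMAIN `R`) of Krull
dimension `≥ 4` (`= 1 + rank` of the polarized ordinary weight space of `U(3)`).  Intended proof:
(a) the universal polarized `S₀`-unramified determinant-deformation ring `R^{univ}` of `r̄` (Chenevier;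
`r̄` absolutely irreducible, so deformations = determinants), the Iwasawa algebra `Λ_{Iw} = 𝒪⟦T(ℤ₃)⟧`,
and Geraghty's PROPER flag scheme `𝒢 → Spec(R^{univ} ⊗̂ Λ_{Iw})` at the place `λ` (pairs `(ρ, Fil)` with
`gr^i Fil` acted on through the `i`-th universal character of `Λ_{Iw}` on inertia; NO residual
distinguishedness needed — it fails for most μ-ordinary Picard curves: the ordered residual diagonal is
`(φ, φ_LT, φ ∘ c)` (triage r1-1), and `φ = φ ∘ c` unless `φ` is a ramified quadratic character);
`ρ_C` with its slope (connected–étale) flag is a point `x_C = (ρ_C, Fil_C)` of `𝒢`, its weight on ONE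
branch `Λ ≅ 𝒪⟦X₁,X₂,X₃⟧` of `Spec Λ_{Iw}` (normal, Noetherian, `dim = 4`);
(b) KISIN AT THE CHARACTERISTIC-ZERO POINT: the complete local ring of `𝒢[1/3]` at `x_C` pro-represents
flag-preserving polarized `S₀`-unramified deformations of `ρ_C` to Artinian `E`-algebras (the flag of
`ρ_C` deforms uniquely: `H⁰(G_{ℚ₃}, ad/𝔟) = 0` since the three diagonal characters have pairwise
distinct Hodge–Tate types), hence is `E⟦x₁,…,x_g⟧/(f₁,…,f_r)` with
`g − r ≥ h⁰(ad) − h⁰(ad(1)) + (dim ℒ₃ − h⁰(G_{ℚ₃}, ad)) − h⁰(G_ℝ, ad) = 0 − 0 + 6 − 3 = 3`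
(Poitou–Tate / Greenberg–Wiles with `E`-coefficients; `h⁰(ad ρ_C(1)) ⊆ Hom_{G_K}(ρ_C, ρ_C(1)) = 0` by
determinants — THE POINT of the line: the residual `μ₃`-deficit is invisible at the motive;
`dim ℒ₃ − h⁰ = [ℚ₃:ℚ₃]·dim 𝔟 + h²(G_{ℚ₃}, 𝔟) − h⁰(G_{ℚ₃}, ad/𝔟) = 6 + 0 − 0` by Hodge–Tate weights
and, for the piece `ψ₃ψ₁⁻¹ε` of `(ad/𝔫)(1)`, by PURITY of the unit root — triage r1-2/r1-3 correction;
archimedean `n(n−1)/2 = 3` for the totally odd polarization; at `v ∈ S₀`, `v ∤ 3` the relative count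
over the unrestricted local lifting rings, equidimensional of dimension `n²`, contributes `≥ 0`); so the
analytic branch `Z ∋ x_C` of the germ of `𝒢` at `(r̄, F̄il_C)` is a complete local domain with
`dim 𝒪(Z) ≥ 3 + 1` (catenarity: `ht P_{x_C} + dim 𝒪(Z)/P_{x_C} = dim 𝒪(Z)`);
(c) THE WITNESS: `R := (R^{univ} ⊗̂ Λ)/𝔮` with `𝔮 = P_Z ∩ (R^{univ} ⊗̂ Λ)` — a complete local
Noetherian DOMAIN, topologically generated over `Λ` by the characteristic-polynomial coefficients
(`generated`), carrying `ρ := ρ^{univ} mod 𝔮`, `wt :=` the universal ordered characters, `x := x_C`;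
every point of `Spec R` lies in the closed image of the proper `𝒢`, so it lifts to `𝒢` (`ordinaryAt`);
`ends` is the slope shape of `ρ_C|Γ_{K_λ}` (unit root unramified, slope-one piece `= ε^{±1}`, over the
good-reduction field of `J`) — now literally the ends clause of the hypothesis `IsMuOrdinaryAtThree ρ_C`,
whose flag clause is the point `Fil_C` of `𝒢` and whose purity clause is what makes
`h²(G_{ℚ₃}, 𝔟) = 0` in (b); and `dim R = dim 𝒪(Z) ≥ 4` because `𝒪(Z)` is an analytic branch, at the point
`F̄il_C`, of the proper birational closure `Z'` of `Spec R` inside `𝒢_R` (`dim 𝒪_{Z',F̄il} = dim R` by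
the dimension formula over the universally catenary `R`, Matsumura 15.6; completions of excellent local
domains are equidimensional, Ratliff).  WHY IT MIGHT FAIL: only through (b) at the non-split place — if
the generic-fibre local ring of `𝒢` at `x_C` were not the flag-deformation functor of the 𝒢₃-valued
(polarized, `K_λ/ℚ₃` ramified) problem with tangent space `im H¹(G_{ℚ₃}, 𝔟)` (Geraghty's `R^△`
formalism transposed to a non-split place: unwritten but formal), or if a bad `v ∤ 3` with
`Hom_{G_v}(ρ_C, ρ_C(1)) ≠ 0` were mishandled (the relative presentation makes its contribution `≥ 0`
regardless).  Sources: Kisin JAMS 21 (2008) §2.3 (2.3.5); Allen arXiv:1411.7661 §1–2 (the same count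
at characteristic-zero polarized points, expected dimension free of `ζ_p`-terms); ClozelHarrisTaylor2008
§2.2–2.3; Geraghty2018 §3 (flag scheme, `R^△`); Chenevier, determinants (arXiv:0809.0415) Lemma 1.12 /
§3; Matsumura, Commutative Ring Theory, Thms 15.6, 31.6–31.7. -/
def S.stub_charZeroFamily : Prop :=
  ∀ (f : ℤ[X]) (ι : PadicAlgCl 3 ≃+* ℂ) (e : K →+* ℂ) (S₀ : Finset (HeightOneSpectrum (𝓞 K)))
    (ρC : FramedGaloisRep K (PadicAlgCl 3) 3),
    Generic f → PicardInput f ι e S₀ ρC → IsMuOrdinaryAtThree ρC →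
    ∃ 𝓕 : OrdFamily f ι e S₀ ρC, ((4 : ℕ) : WithBot ℕ∞) ≤ ringKrullDim 𝓕.R

/-- STUB 3 — **THE HOST OVER `F'` (HARDEST; the card's K1 = weight-blind's K1, in the universal form
this line needs).**  For `(f, ρ_C)` in the main class (gen 2: `ρ_C` μ-ordinary at `3` Galois-side, image
`S₄` over `K`) and EVERY `OrdFamily 𝓕` through `ρ_C`:
(i) `𝓕.R` is module-finite over `𝓕.Λ`; (ii) there are a quadratic extension `F'/K` (intended
`F' = K(√d)`, `d ≡ 6 (mod 9)` squarefree positive with `(d/ℓ) = −1` at every inert bad `ℓ` and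
`ℚ(√d) ⊄ K·split(f)`: then `λ` and all of `S₀` split in `F'/ℚ(√d)`, `F'_w = K_λ`, and `ρ̄_C(Γ_{F'}) = S₄`),
a level `S'` above `S₀`, a finite `E/ℚ₃` and a set `D` of `E`-integral `Λ`-weights ("arithmetic
weights": regular dominant algebraic times the finite-order part of the weight of `ρ_C`) accumulating
UNIFORMLY at the weight `j ∘ x|_Λ` of the Picard point, such that every `ℚ̄₃`-point `y` of `𝓕.R` over `D`
is CLASSICAL OVER `F'`: `y ∘ tr ρ = tr ρ_y` for a continuous `ρ_y : Γ_K → GL₃(ℚ̄₃)`, absolutely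
irreducible on `Γ_{F'}` (automatic: `r̄|Γ_{F'}` is), whose restriction to `Γ_{F'}` is attached
(lang.S27 compatibility at every `w ∉ S'`, `w ∤ 3`) to a regular algebraic cuspidal `P'_y` of
`GL₃(𝔸_{F'})` unramified outside `S'`.  Intended proof: by `generated` and Chenevier, `𝓕.R` is a
quotient of `R^{univ}_K ⊗̂ Λ`; by `ordinaryAt` every `ℚ̄₃`-point of the DOMAIN `𝓕.R` (Zariski dense:
`R[1/3]` is Jacobson, `3 ≠ 0`) lies in Geraghty's closed `△`-locus, so the `△`-ideal dies in `𝓕.R` and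
`𝓕.R` is a quotient of `R^△_K ⊗̂_{Λ_{Iw}} Λ`; `R^△_K` is finite over `R^△_{F'}` (BLGGT Lemma 1.2.3-type
finiteness under restriction, `r̄|Γ_{F'}` absolutely irreducible), and `R^{△,red}_{F'} = T^{ord}_{F'}`
— Geraghty's `Λ`-adic ordinary patching on the DEFINITE unitary group `U(3)_{F'/ℚ(√d)}` at the split
prime `3` (`p = n = 3`, `ζ₃ ∈ F'`: generator/relation count off by the `κ ⊗ Id` class, Taylor–Wiles
primes `q ≡ 1 mod 3^N` with an `𝔽₉`-rational distinguished eigenvalue, `S₄` is `ad/𝔷`-adequate over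
`𝔽₉`, kit j007087/j007470; the residual seed `T_𝔪 ≠ 0` is the route's `ResidualAutomorphyOdd/Even`
made ordinary at `λ` and base-changed to `F'`) — with `T^{ord}_{F'}` finite over `Λ_{F'} → Λ_K`;
classicality of `D`-points: `ρ_y|Γ_{F'}` is an arithmetic-weight point of `T^{ord}_{F'}`, classical by
Hida–Geraghty control (Geraghty2018 §2, Lemma 2.4-type), an automorphic representation of `U(3)` whose
base change to `GL₃/F'` (Rogawski / Labesse, `n` odd) is cuspidal (irreducible Galois representation)
regular algebraic, unramified outside `S'`, compatible by lang.S27 / Caraiani at `w ∤ 3`.  The weight of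
`x_C` (locally algebraic diagonal characters, `ends`) is a `3`-adic limit of arithmetic weights on the
branch `Λ`: `D` accumulates.  WHY IT MIGHT FAIL: every printed hypothesis of the patching is violated
at `p = n = 3`, `ζ₃ ∈ F'` (Thorne2012 adequacy, Geraghty2018 `p > 2n?`, BLGGT `ζ_p ∉ F`); the
`μ₃`-class must be balanced by hand; ordinary control at the irregular-adjacent weights needs `D`
sufficiently regular (free).  Sources: Geraghty2018; Thorne2012; arXiv:1405.0043 (GHT, adequacy for
`p ∣ n`); BarnetLambEtAl2014 (BLGGT) §1.2, §4; ClozelHarrisTaylor2008; Labesse (Astérisque 257 / Paris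
book project); Caraiani2014; HarrisLanTaylorThorneRMS2016. -/
def S.stub_definiteHost : Prop :=
  ∀ (f : ℤ[X]) (ι : PadicAlgCl 3 ≃+* ℂ) (e : K →+* ℂ) (S₀ : Finset (HeightOneSpectrum (𝓞 K)))
    (ρC : FramedGaloisRep K (PadicAlgCl 3) 3) (𝓕 : OrdFamily f ι e S₀ ρC),
    Generic f → PicardInput f ι e S₀ ρC → MainClass f ρC →
    Module.Finite 𝓕.Λ 𝓕.R ∧
    ∃ (F' : Type) (_ : Field F') (_ : NumberField F') (_ : Algebra K F')
      (hcpt' : isCompact_glFiniteIntegralLevel 3 F') (S' : Finset (HeightOneSpectrum (𝓞 F')))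
      (D : Set (𝓕.Λ →+* PadicAlgCl 3)) (E : IntermediateField ℚ_[3] (PadicAlgCl 3)),
      Module.finrank K F' = 2 ∧ FiniteDimensional ℚ_[3] E ∧
      (∀ w : HeightOneSpectrum (𝓞 F'), w.under (𝓞 K) ∈ S₀ → w ∈ S') ∧
      (∀ κ ∈ D, ∀ a : 𝓕.Λ, κ a ∈ E ∧ ‖κ a‖ ≤ 1) ∧
      (∀ M : ℕ, ∃ κ ∈ D, ∀ a : 𝓕.Λ,
        ‖κ a - 𝓕.j (𝓕.x (algebraMap 𝓕.Λ 𝓕.R a))‖ ≤ ((3 : ℝ)⁻¹) ^ M) ∧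
      (∀ y : 𝓕.R →+* PadicAlgCl 3, y.comp (algebraMap 𝓕.Λ 𝓕.R) ∈ D →
        ∃ ρy : FramedGaloisRep K (PadicAlgCl 3) 3,
          (∀ g, FramedRep.trace ρy g = y (𝓕.ρ g).val.trace) ∧
          FramedRep.IsAbsolutelyIrreducible (ρy.restrictField F') ∧
          ∃ P' : CuspidalAutomorphicRepData 3 F' hcpt',
            P'.1.IsRegularAlgebraic ∧
            ∀ w ∉ S', (∃ α : Multiset ℂ, P'.1.HasSatakeParamAt w α) ∧
              (((3 : ℕ) : 𝓞 F') ∉ w.asIdeal → IsGaloisCompatibleAt P'.1 ι (ρy.restrictField F') w))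

/-- STUB 4 — **accumulation of arithmetic points** (pure commutative algebra + `3`-adic analysis,
provable now; size M/L).  VERBATIM weight-blind's Stub C (one proof serves both lines): `Λ` a
Noetherian integrally closed domain, `R` a finite `Λ`-algebra, `x : R → ℚ̄₃` integral on `Λ`, a prime
`𝔮 ⊆ ker x` with `𝔮 ∩ Λ = 0` (here: `𝔮 = ⊥` of the integral family, dominating by
`algebraMap_injective_of_ringKrullDim_le`), `D` a set of `Λ`-points with values in the integers of one
finite `E/ℚ₃` accumulating at `x|_Λ` uniformly ⇒ points of `R` over `D` accumulate at `x` UNIFORMLY on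
`R`.  Intended proof (Disproof cycle 1 checked it end to end): `B = R/𝔮` finite torsion-free over the
normal `Λ`; finite fibre over `κ = x|_Λ`; a separating element `b` (B.H. Neumann); `Λ[b] ≅ Λ[X]/(F_b)`
(normality); root continuity; lying over + `IsAlgClosed.lift`; compactness of bounded-degree points;
ultrametric bookkeeping.  Dominance and normality are LOAD-BEARING (landed negatives p74393, p74844,
re-exported above). -/
def S.stub_accumulation : Prop :=
  ∀ (Λ R : Type) [CommRing Λ] [IsDomain Λ] [IsNoetherianRing Λ] [IsIntegrallyClosed Λ]
    [CommRing R] [Algebra Λ R] [Module.Finite Λ R]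
    (x : R →+* PadicAlgCl 3) (D : Set (Λ →+* PadicAlgCl 3))
    (E : IntermediateField ℚ_[3] (PadicAlgCl 3)), FiniteDimensional ℚ_[3] E →
    (∃ 𝔮 : Ideal R, 𝔮.IsPrime ∧ Ideal.comap (algebraMap Λ R) 𝔮 = ⊥ ∧ ∀ r ∈ 𝔮, x r = 0) →
    (∀ a : Λ, ‖x (algebraMap Λ R a)‖ ≤ 1) →
    (∀ κ ∈ D, ∀ a : Λ, κ a ∈ E ∧ ‖κ a‖ ≤ 1) →
    (∀ m : ℕ, ∃ κ ∈ D, ∀ a : Λ, ‖κ a - x (algebraMap Λ R a)‖ ≤ ((3 : ℝ)⁻¹) ^ m) →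
    ∀ m : ℕ, ∃ y : R →+* PadicAlgCl 3, y.comp (algebraMap Λ R) ∈ D ∧
      ∀ r : R, ‖y r - x r‖ ≤ ((3 : ℝ)⁻¹) ^ m

/-- STUB 5 — **quadratic (cyclic) descent `F' → K` with level, compatibility and integrality**
(Arthur–Clozel, Ann. Math. Studies 120, Ch. 3, Thm. 4.2 (d); known; size L).  VERBATIM weight-blind's
Stub D: `F'/K` quadratic, `ρ : Γ_K → GL₃(ℚ̄₃)` with `ρ|Γ_{F'}` absolutely irreducible, `P'` regular
algebraic cuspidal on `GL₃(𝔸_{F'})` unramified outside `S'` and compatible with `ρ|Γ_{F'}` off `S'`;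
then there is a regular algebraic cuspidal `P` on `GL₃(𝔸_K)`, unramified outside a finite `S`
depending only on `(F'/K, S')` (places under `S'`, ramified in `F'/K`, above `3` — the quantifier
order `∃ S ∀ ρ P'` was audited by the Disproof), with `N𝔭·Σ Satake ∈ ℤ̄` at every `𝔭 ∉ S` and
compatible with `ρ` at every `𝔭 ∉ S`, `𝔭 ∤ 3` (`P'^σ ≅ P'` by strong multiplicity one since both
match `ρ`; cuspidal descent `P₀`; `r(P₀)|Γ_{F'} ≅ ρ|Γ_{F'}` pins `r(P₀) ≅ ρ ⊗ χ^a`; twist back;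
Clozel integrality).  Tree: `ArthurClozel1989_weakLifting_cuspidal`, `cuspidal_descent_cyclic`-type
facts, `exists_galoisRep_of_regularAlgebraic` (lang.S27), `strong_multiplicity_one_gl`. -/
def S.stub_quadraticDescent : Prop :=
  ∀ (F' : Type) [Field F'] [NumberField F'] [Algebra K F'],
    Module.finrank K F' = 2 →
  ∀ (hcpt : isCompact_glFiniteIntegralLevel 3 (CyclotomicField 3 ℚ))
    (hcpt' : isCompact_glFiniteIntegralLevel 3 F') (ι : PadicAlgCl 3 ≃+* ℂ)
    (S' : Finset (HeightOneSpectrum (𝓞 F'))),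
  ∃ S : Finset (HeightOneSpectrum (𝓞 K)),
    ∀ (ρ : FramedGaloisRep K (PadicAlgCl 3) 3) (P' : CuspidalAutomorphicRepData 3 F' hcpt'),
      FramedRep.IsAbsolutelyIrreducible (ρ.restrictField F') →
      P'.1.IsRegularAlgebraic →
      (∀ w ∉ S', (∃ α : Multiset ℂ, P'.1.HasSatakeParamAt w α) ∧
        (((3 : ℕ) : 𝓞 F') ∉ w.asIdeal → IsGaloisCompatibleAt P'.1 ι (ρ.restrictField F') w)) →
      ∃ P : CuspidalAutomorphicRepData 3 (CyclotomicField 3 ℚ) hcpt,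
        P.1.IsRegularAlgebraic ∧
        ∀ 𝔭 ∉ S, (∃ (α : Multiset ℂ) (t₀ : integralClosure ℤ ℂ),
            P.1.HasSatakeParamAt 𝔭 α ∧ (t₀ : ℂ) = (𝔭.residueCard : ℂ) * α.sum) ∧
          (((3 : ℕ) : 𝓞 K) ∉ 𝔭.asIdeal → IsGaloisCompatibleAt P.1 ι ρ 𝔭)

/-- STUB 6 — **the dictionary to the typed `ℤ̄_𝔐`-congruence** (provable now; size M).  VERBATIM
weight-blind's Stub E: for `ι : ℚ̄₃ ≃ ℂ` put `𝔐 = {z ∈ ℤ̄ : ‖ι⁻¹ z‖ < 1}` (maximal, `∋ 3`); if `ρ` has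
geometric-Frobenius trace `ι⁻¹(e(a_𝔭 f))` at `𝔭 ∤ 3`, `ρ'` has arithmetic-Frobenius characteristic
polynomial `arithFrobPolyOfSatake ι N𝔭 3 α` at `𝔭` (so `tr ρ'(Frob_𝔭⁻¹) = ι⁻¹(N𝔭·Σ α)`),
`N𝔭·Σα = t₀ ∈ ℤ̄`, and `‖tr ρ' − tr ρ‖ ≤ 3^{-k}` on `Γ_K`, then `t = t₀ − e(a_𝔭 f) ∈ ℤ̄` has
`u·t ∈ 3^k ℤ̄` for some `u ∉ 𝔐` (`ℤ̄_𝔐` is the valuation ring of the place `ι⁻¹` on `ℚ̄`; CRT in the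
number field `ℚ(t)`).  This is the refuter's reading `u ∉ 𝔐 ∧ u·t ∈ (3^k) ⇔ v_𝔐(t) ≥ k·v(3)`
(Disproof F3; do NOT restate as `t ∈ 𝔐^k`, trap (a)). -/
def S.stub_dictionary : Prop :=
  ∀ (ι : PadicAlgCl 3 ≃+* ℂ) (e : K →+* ℂ),
  ∃ 𝔐 : Ideal (integralClosure ℤ ℂ), 𝔐.IsMaximal ∧ (3 : integralClosure ℤ ℂ) ∈ 𝔐 ∧
    ∀ (k : ℕ) (f : ℤ[X]) (ρ ρ' : FramedGaloisRep K (PadicAlgCl 3) 3)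
      (𝔭 : HeightOneSpectrum (𝓞 K)) (α : Multiset ℂ) (t₀ : integralClosure ℤ ℂ),
      ((3 : ℕ) : 𝓞 K) ∉ 𝔭.asIdeal →
      (ρ.IsUnramifiedAt 𝔭 ∧
        ∀ 𝔓 ∈ 𝔭.primesAbove, ∀ τ : absoluteGaloisGroup K,
          IsArithFrobAt (𝓞 K) τ 𝔓 → FramedRep.trace ρ τ⁻¹ = ι.symm (e (picardTrace f 𝔭))) →
      ρ'.HasFrobCharpolyAt 𝔭 (arithFrobPolyOfSatake ι 𝔭.residueCard 3 α) →
      (t₀ : ℂ) = (𝔭.residueCard : ℂ) * α.sum →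
      (∀ g, ‖FramedRep.trace ρ' g - FramedRep.trace ρ g‖ ≤ ((3 : ℝ)⁻¹) ^ k) →
      ∃ (t u : integralClosure ℤ ℂ),
        (t : ℂ) = (𝔭.residueCard : ℂ) * α.sum - e (picardTrace f 𝔭) ∧
        u ∉ 𝔐 ∧ u * t ∈ Ideal.span {(3 : integralClosure ℤ ℂ) ^ k}

/-- STUB 7 — **NOT A LEMMA OF THIS LINE: the conceded complement.**  The crux as typed for generic `f`
with its Picard representation `ρ_C` (Stub 1's output, pinned up to isomorphism by `PicardInput`) OUTSIDE
the main class: `ρ_C` not μ-ordinary at `3` in the sense `IsMuOrdinaryAtThree` — BBW stable types (a), (c)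
(λ-supersingular: `y³ − y = x⁴` resp. three supersingular elliptic components; no unit root, finite slope,
possibly supercuspidal type: no engine in any line, refuter O1, Disproof F8 — the route's foreseen
`RTSupersingular` child) and (d), (e) (toric rank `2` at `λ`: the flag exists but fails the purity clause;
plausibly reachable by this very lever with Geraghty's equidimensional `R^△` at the semistable point —
the line card's first widening, not claimed) — or `ρ̄_C(Γ_K) = A₄` (`Gal(f) = A₄`, or `S₄` with
`K ⊂ split(f)`: every adequacy clause fails, `H¹(A₄, 𝔽₃) ≠ 0`; the Skinner–Wiles-type lines
`free-seed-smooth-rt` / `klein-split-eisenstein-host` would be the engines).  Gen 2: this is a GENUINE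
complement (gen 1's curve-level scope was empty, so its remainder was the whole crux).  Registered only so
that the composition concludes the crux BY NAME; no prover of this line should claim it; the tenure
planner should convert it into the planned split of `MuOrdinaryFamilyRT` (route two-layer plan (1), kill
criterion 4) — with D1 re-typed Jacobian/Galois-side as here. -/
def S.stub_remainder : Prop :=
  ∀ (f : ℤ[X]) (hcpt : isCompact_glFiniteIntegralLevel 3 (CyclotomicField 3 ℚ))
    (ι : PadicAlgCl 3 ≃+* ℂ) (e : K →+* ℂ) (S₀ : Finset (HeightOneSpectrum (𝓞 K)))
    (ρC : FramedGaloisRep K (PadicAlgCl 3) 3),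
    Generic f → PicardInput f ι e S₀ ρC → ¬ MainClass f ρC → ResidualHyp f hcpt → LimitConcl f hcpt

theorem stub_picardInput : S.stub_picardInput := by
  sorry

theorem stub_charZeroFamily : S.stub_charZeroFamily := by
  sorry

theorem stub_definiteHost : S.stub_definiteHost := by
  sorry

theorem stub_accumulation : S.stub_accumulation := by
  sorry

theorem stub_quadraticDescent : S.stub_quadraticDescent := by
  sorry

theorem stub_dictionary : S.stub_dictionary := by
  sorry

theorem stub_remainder : S.stub_remainder := by
  sorry

/-! ## 6. The composition: the seven stubs imply the crux, by name (kernel-checked, no sorry of its own) -/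

/-- **The line concludes the crux.**  For generic `f`: `stub_picardInput` (`ρ_C`) first; then outside
the main class `MainClass f ρ_C` by `stub_remainder` (which alone consumes the residual hypothesis);
inside it: `stub_charZeroFamily` (an integral `4`-dimensional ordinary family `𝓕` through `ρ_C`: the
characteristic-zero count) → `stub_definiteHost` (`𝓕.R` finite over `𝓕.Λ`; arithmetic weights `D`;
classicality over `F'`) → `algebraMap_injective_of_ringKrullDim_le` (DOMINANCE `𝓕.Λ ↪ 𝓕.R`, proved) →
`stub_accumulation` (for each `k` an arithmetic point `y_k` with `‖y_k − x_C‖ ≤ 3^{-k}` on `𝓕.R`,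
hence `‖tr ρ_{y_k} − tr ρ_C‖ ≤ 3^{-k}` on `Γ_K`) → `stub_quadraticDescent` (`P_k` on `GL₃(𝔸_K)`,
level `S`, integral, compatible with `ρ_{y_k}`) → `stub_dictionary` (the typed congruence at every
`𝔭 ∉ S ∪ S₀`). -/
theorem MuOrdinaryFamilyRT_of (h₁ : S.stub_picardInput) (h₂ : S.stub_charZeroFamily)
    (h₃ : S.stub_definiteHost) (h₄ : S.stub_accumulation) (h₅ : S.stub_quadraticDescent)
    (h₆ : S.stub_dictionary) (h₇ : S.stub_remainder) :
    Summit.Langlands.Langlands.Theses.PicardMuOrdinary.MuOrdinaryFamilyRT := by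
  refine crux_iff.mpr ?_
  intro f hcpt hdeg hsep hgal hres
  have hgen : Generic f := ⟨hdeg, hsep, hgal⟩
  -- Stub 1: the Picard representation and its Frobenius traces
  obtain ⟨ι, e, S₀, ρC, hin⟩ := h₁ f hgen
  -- the scope (gen 2): μ-ordinarity of ρ_C at λ (Galois side) and S₄ image; else the conceded remainder
  by_cases hM : MainClass f ρC
  swap
  · exact h₇ f hcpt ι e S₀ ρC hgen hin hM hres
  have hmu : IsMuOrdinaryAtThree ρC := hM.1
  have hS₀ : ∀ v : HeightOneSpectrum (𝓞 K), ((3 : ℕ) : 𝓞 K) ∈ v.asIdeal → v ∈ S₀ := hin.1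
  have htr := hin.2.2
  -- Stub 2 (the lever): an integral ordinary family of dimension ≥ 4 through ρ_C
  obtain ⟨𝓕, hdim⟩ := h₂ f ι e S₀ ρC hgen hin hmu
  -- Stub 3 (the host): finiteness over Λ, arithmetic weights, classicality over F'
  obtain ⟨hfin, F', _instF, _instNF, _instA, hcpt', S', D, E, hdegF', hE, hS', hDint, hDacc,
      hclass⟩ := h₃ f ι e S₀ ρC 𝓕 hgen hin hM
  haveI : Module.Finite 𝓕.Λ 𝓕.R := hfin
  -- DOMINANCE (kernel-checked): Λ ↪ R, i.e. the prime ⊥ of the integral family lies over ⊥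
  have hinj : Function.Injective (algebraMap 𝓕.Λ 𝓕.R) :=
    algebraMap_injective_of_ringKrullDim_le 𝓕.dim_le hdim
  -- the Picard point as a ℚ̄₃-valued point of R
  let xq : 𝓕.R →+* PadicAlgCl 3 := 𝓕.j.comp (𝓕.x : 𝓕.R →+* 𝓕.𝒪)
  have hxq : ∀ r, xq r = 𝓕.j (𝓕.x r) := fun r => rfl
  have hdom : ∃ 𝔮 : Ideal 𝓕.R, 𝔮.IsPrime ∧ Ideal.comap (algebraMap 𝓕.Λ 𝓕.R) 𝔮 = ⊥ ∧
      ∀ r ∈ 𝔮, xq r = 0 := by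
    refine ⟨⊥, Ideal.isPrime_bot, ?_, fun r hr => ?_⟩
    · rw [← RingHom.ker_eq_comap_bot]
      exact (RingHom.injective_iff_ker_eq_bot _).mp hinj
    · rw [Ideal.mem_bot] at hr
      rw [hr, map_zero]
  have hxint : ∀ a : 𝓕.Λ, ‖xq (algebraMap 𝓕.Λ 𝓕.R a)‖ ≤ 1 := fun a => by
    rw [hxq]; exact 𝓕.j_norm_le _
  have hDacc' : ∀ M : ℕ, ∃ κ ∈ D, ∀ a : 𝓕.Λ,
      ‖κ a - xq (algebraMap 𝓕.Λ 𝓕.R a)‖ ≤ ((3 : ℝ)⁻¹) ^ M := by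
    intro M
    obtain ⟨κ, hκ, h⟩ := hDacc M
    exact ⟨κ, hκ, fun a => by rw [hxq]; exact h a⟩
  -- Stub 5: the descent datum (a level S over K, uniform in the point)
  obtain ⟨S, hdesc⟩ := h₅ F' hdegF' hcpt hcpt' ι S'
  -- Stub 6: the maximal ideal 𝔐 of ℤ̄ cut out by ι
  obtain ⟨𝔐, h𝔐max, h𝔐3, hdict⟩ := h₆ ι e
  refine ⟨e, 𝔐, S ∪ S₀, h𝔐max, h𝔐3, fun k => ?_⟩
  -- Stub 4: an arithmetic point y of R with ‖y − x‖ ≤ 3^{-k} uniformly on R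
  obtain ⟨y, hyD, hyx⟩ := h₄ 𝓕.Λ 𝓕.R xq D E hE hdom hxint hDint hDacc' k
  obtain ⟨ρy, hρyT, hρyirr, P', hP'reg, hP'⟩ := hclass y hyD
  obtain ⟨P, hPreg, hP⟩ := hdesc ρy P' hρyirr hP'reg hP'
  refine ⟨P, hPreg, fun 𝔭 h𝔭 => ?_⟩
  have h𝔭S : 𝔭 ∉ S := fun h => h𝔭 (Finset.mem_union_left _ h)
  have h𝔭S₀ : 𝔭 ∉ S₀ := fun h => h𝔭 (Finset.mem_union_right _ h)
  have h3 : ((3 : ℕ) : 𝓞 K) ∉ 𝔭.asIdeal := fun h => h𝔭S₀ (hS₀ 𝔭 h)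
  obtain ⟨⟨α, t₀, hα, ht₀⟩, hcomp⟩ := hP 𝔭 h𝔭S
  have happrox : ∀ g, ‖FramedRep.trace ρy g - FramedRep.trace ρC g‖ ≤ ((3 : ℝ)⁻¹) ^ k := by
    intro g
    rw [hρyT g, ← 𝓕.x_trace g, ← hxq]
    exact hyx _
  obtain ⟨t, u, ht, hu, hut⟩ :=
    hdict k f ρC ρy 𝔭 α t₀ h3 (htr 𝔭 h𝔭S₀) ((hcomp h3) α hα).2 ht₀ happrox
  exact ⟨α, t, u, hα, ht, hu, hut⟩

/-- The crux from the seven stubs (sorries live only inside `stub_*`). -/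
theorem MuOrdinaryFamilyRT_proof :
    Summit.Langlands.Langlands.Theses.PicardMuOrdinary.MuOrdinaryFamilyRT :=
  MuOrdinaryFamilyRT_of stub_picardInput stub_charZeroFamily stub_definiteHost stub_accumulation
    stub_quadraticDescent stub_dictionary stub_remainder

end

end Summit.Langlands.Langlands.Cruxes.MuOrdinaryFamilyRT.CharZeroDominance
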